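import Mathlib.Data.Matrix.Mul
import Mathlib.Algebra.BigOperators.Fin
import Mathlib.Algebra.Order.Floor.Ring
import Literature.Analysis.FluidPDE.FluidComputer.TubeCheck
import HarnessLib

/-!
# Dyadic-interval vectors, matrices, Horner evaluation and sub-interval covering
# (the executable primitives of the ramp-enclosure ROW CHECKER, `pub-fluidc-bp3/R1-DESIGN.md` §9.4)

HONEST FRAMING (cell `pub-fluidc`, blueprint seat bp3, gen 20): low prior, high value-of-information
experiment on Tao's machine paradigm; NOT a claim that NS blows up. Elementary interval arithmetic.

Layer B of `structure Row` (the table layer under `RowModel.row_sound`) recomputes the kernel's tables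
(`code/thgate/g19/kgen19.py`, `row_check`) in the in-tree exact dyadic interval arithmetic
`Literature.Analysis.FluidPDE.FluidComputer.DI` and checks its inequalities by `decide`. This file is the
bit-exact Lean twin of the kernel's COMPOSITE interval operations (`code/thgate/g18/di.py`: `dot`, `matmul`,
`horner`, the `KSUB` sub-interval hulls) over `Fin`-indexed vectors and matrices of intervals, each with
its soundness lemma against `Matrix.mulVec` / matrix product / `Σ_{m ≤ n} a_m u^m` on the reals:
`sumFin` (left fold, as the kernel's accumulator), `dot`/`mem_dot`, `mulVec`/`mem_mulVec`, `mul`/`mem_mul`,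
entrywise `add`/`sub`/`smul`/`hull` of interval matrices, `horner`/`mem_horner` (right-to-left Horner,
`acc ← c_k + acc·U`, the kernel's order), the sub-interval `subI P H KS k = [⌊k H/KS · 2^P⌋, ⌈(k+1) H/KS · 2^P⌉]`
of `[0, H]` with `mem_subI`, and the covering lemma `exists_subinterval` (every `u ∈ [0, H]` lies in one of
the `KS` closed sub-intervals) by which a bound checked on every sub-interval holds on `[0, H]`.

[cite: Tao2016AveragedNS, §5.5 Thm 5.3 (5.5)]
-/

open Finset BigOperators

namespace Summit.NavierStokesRegularity.FluidComputer

open Literature.Analysis.FluidPDE.FluidComputer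

namespace DIVec

variable (P : ℕ)

/-! ### Sums and products -/

/-- `Σ_{i < n} f i` as a left fold (`((0 + f 0) + f 1) + …`, the kernel's accumulator). [folklore] -/
def sumFin : (n : ℕ) → (Fin n → DI) → DI
  | 0, _ => DI.pt 0
  | n + 1, f => (sumFin n (fun i => f (Fin.castSucc i))).add (f (Fin.last n))

/-- Soundness of `sumFin`. [folklore] -/
theorem mem_sumFin : ∀ (n : ℕ) {f : Fin n → DI} {x : Fin n → ℝ},
    (∀ i, (f i).mem P (x i)) → (sumFin n f).mem P (∑ i, x i)
  | 0, _, _, _ => by simpa [sumFin] using DI.mem_pt P 0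
  | n + 1, _, _, h => by
      rw [Fin.sum_univ_castSucc]
      exact DI.mem_add (mem_sumFin n (fun i => h _)) (h _)

/-- Interval dot product (`di.dot`). [folklore] -/
def dot {n : ℕ} (a b : Fin n → DI) : DI := sumFin n (fun i => (a i).mul P (b i))

/-- Soundness of `dot`. [folklore] -/
theorem mem_dot {n : ℕ} {a b : Fin n → DI} {x y : Fin n → ℝ} (ha : ∀ i, (a i).mem P (x i))
    (hb : ∀ i, (b i).mem P (y i)) : (dot P a b).mem P (∑ i, x i * y i) :=
  mem_sumFin P n (fun i => DI.mem_mul (ha i) (hb i))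

/-- Interval matrix × interval vector. [folklore] -/
def mulVec {m n : ℕ} (A : Fin m → Fin n → DI) (v : Fin n → DI) : Fin m → DI :=
  fun i => dot P (A i) v

/-- Soundness of `mulVec` against `Matrix.mulVec`. [folklore] -/
theorem mem_mulVec {m n : ℕ} {A : Fin m → Fin n → DI} {v : Fin n → DI}
    {M : Matrix (Fin m) (Fin n) ℝ} {x : Fin n → ℝ} (hA : ∀ i j, (A i j).mem P (M i j))
    (hv : ∀ j, (v j).mem P (x j)) (i : Fin m) : (mulVec P A v i).mem P (M.mulVec x i) := by
  simp only [Matrix.mulVec, dotProduct]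
  exact mem_dot P (hA i) hv

/-- Interval matrix product (`di.matmul`). [folklore] -/
def mul {m n k : ℕ} (A : Fin m → Fin n → DI) (B : Fin n → Fin k → DI) : Fin m → Fin k → DI :=
  fun i l => dot P (A i) (fun j => B j l)

/-- Soundness of `mul` against the matrix product. [folklore] -/
theorem mem_mul {m n k : ℕ} {A : Fin m → Fin n → DI} {B : Fin n → Fin k → DI}
    {M : Matrix (Fin m) (Fin n) ℝ} {N : Matrix (Fin n) (Fin k) ℝ} (hA : ∀ i j, (A i j).mem P (M i j))
    (hB : ∀ j l, (B j l).mem P (N j l)) (i : Fin m) (l : Fin k) :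
    (mul P A B i l).mem P ((M * N) i l) := by
  rw [Matrix.mul_apply]
  exact mem_dot P (hA i) (fun j => hB j l)

/-! ### Entrywise operations on interval matrices -/

/-- Entrywise sum. [folklore] -/
def addM {m n : ℕ} (A B : Fin m → Fin n → DI) : Fin m → Fin n → DI := fun i j => (A i j).add (B i j)

/-- Soundness of `addM`. [folklore] -/
theorem mem_addM {m n : ℕ} {A B : Fin m → Fin n → DI} {M N : Matrix (Fin m) (Fin n) ℝ}
    (hA : ∀ i j, (A i j).mem P (M i j)) (hB : ∀ i j, (B i j).mem P (N i j)) (i : Fin m) (j : Fin n) :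
    (addM A B i j).mem P ((M + N) i j) := DI.mem_add (hA i j) (hB i j)

/-- Entrywise difference. [folklore] -/
def subM {m n : ℕ} (A B : Fin m → Fin n → DI) : Fin m → Fin n → DI := fun i j => (A i j).sub (B i j)

/-- Soundness of `subM`. [folklore] -/
theorem mem_subM {m n : ℕ} {A B : Fin m → Fin n → DI} {M N : Matrix (Fin m) (Fin n) ℝ}
    (hA : ∀ i j, (A i j).mem P (M i j)) (hB : ∀ i j, (B i j).mem P (N i j)) (i : Fin m) (j : Fin n) :
    (subM A B i j).mem P ((M - N) i j) := DI.mem_sub (hA i j) (hB i j)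

/-- Interval scalar × interval matrix, entrywise. [folklore] -/
def smulM {m n : ℕ} (s : DI) (A : Fin m → Fin n → DI) : Fin m → Fin n → DI :=
  fun i j => s.mul P (A i j)

/-- Soundness of `smulM`. [folklore] -/
theorem mem_smulM {m n : ℕ} {s : DI} {A : Fin m → Fin n → DI} {r : ℝ} {M : Matrix (Fin m) (Fin n) ℝ}
    (hs : s.mem P r) (hA : ∀ i j, (A i j).mem P (M i j)) (i : Fin m) (j : Fin n) :
    (smulM P s A i j).mem P ((r • M) i j) := by
  rw [Matrix.smul_apply, smul_eq_mul]
  exact DI.mem_mul hs (hA i j)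

/-- Entrywise hull of two interval matrices. [folklore] -/
def hullM {m n : ℕ} (A B : Fin m → Fin n → DI) : Fin m → Fin n → DI := fun i j => (A i j).hull (B i j)

/-- The hull contains the first matrix. [folklore] -/
theorem mem_hullM_left {m n : ℕ} {A B : Fin m → Fin n → DI} {M : Matrix (Fin m) (Fin n) ℝ}
    (hA : ∀ i j, (A i j).mem P (M i j)) (i : Fin m) (j : Fin n) : (hullM A B i j).mem P (M i j) :=
  DI.mem_hull_left (hA i j)

/-- The hull contains the second matrix. [folklore] -/
theorem mem_hullM_right {m n : ℕ} {A B : Fin m → Fin n → DI} {N : Matrix (Fin m) (Fin n) ℝ}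
    (hB : ∀ i j, (B i j).mem P (N i j)) (i : Fin m) (j : Fin n) : (hullM A B i j).mem P (N i j) :=
  DI.mem_hull_right (hB i j)

/-- Entrywise magnitude bound read off an interval matrix: `|M i j| ≤ mag / 2^P`. [folklore] -/
theorem abs_le_magM {m n : ℕ} {A : Fin m → Fin n → DI} {M : Matrix (Fin m) (Fin n) ℝ}
    (hA : ∀ i j, (A i j).mem P (M i j)) (i : Fin m) (j : Fin n) :
    |M i j| ≤ ((A i j).mag : ℝ) / 2 ^ P := DI.abs_le_mag (hA i j)

/-- Entrywise magnitude bound read off an interval vector. [folklore] -/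
theorem abs_le_magV {n : ℕ} {v : Fin n → DI} {x : Fin n → ℝ} (hv : ∀ j, (v j).mem P (x j))
    (j : Fin n) : |x j| ≤ ((v j).mag : ℝ) / 2 ^ P := DI.abs_le_mag (hv j)

/-! ### Horner evaluation -/

/-- `hornerFrom c U k r` encloses `Σ_{i ≤ r} c (k+i) u^i` (right-to-left Horner:
`c k + U · hornerFrom c U (k+1) (r-1)`, the kernel's `acc ← add(c, mul(acc, U))`). [folklore] -/
def hornerFrom (c : ℕ → DI) (U : DI) : ℕ → ℕ → DI
  | k, 0 => c k
  | k, r + 1 => (c k).add ((hornerFrom c U (k + 1) r).mul P U)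

/-- `horner c n U` encloses `Σ_{m ≤ n} c m u^m` for `u ∈ U` (`di.horner`). [folklore] -/
def horner (c : ℕ → DI) (n : ℕ) (U : DI) : DI := hornerFrom P c U 0 n

/-- Soundness of `hornerFrom`. [folklore] -/
theorem mem_hornerFrom {c : ℕ → DI} {a : ℕ → ℝ} {U : DI} {u : ℝ} (hc : ∀ m, (c m).mem P (a m))
    (hu : U.mem P u) : ∀ (r k : ℕ),
    (hornerFrom P c U k r).mem P (∑ i ∈ range (r + 1), a (k + i) * u ^ i)
  | 0, k => by simpa [hornerFrom] using hc k
  | r + 1, k => by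
      have ih := mem_hornerFrom hc hu r (k + 1)
      have hsplit : ∑ i ∈ range (r + 2), a (k + i) * u ^ i
          = a k + (∑ i ∈ range (r + 1), a (k + 1 + i) * u ^ i) * u := by
        rw [Finset.sum_range_succ', Finset.sum_mul]
        simp only [pow_zero, mul_one, add_zero, pow_succ]
        rw [add_comm]
        congr 1
        refine Finset.sum_congr rfl fun i _ => ?_
        rw [show k + (i + 1) = k + 1 + i by omega]
        ring
      rw [hsplit]
      exact DI.mem_add (hc k) (DI.mem_mul ih hu)

/-- **Soundness of `horner`**: `Σ_{m ≤ n} a m · u^m ∈ horner c n U` whenever `a m ∈ c m` and `u ∈ U`.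
[folklore] -/
theorem mem_horner {c : ℕ → DI} {a : ℕ → ℝ} {U : DI} {u : ℝ} (hc : ∀ m, (c m).mem P (a m))
    (hu : U.mem P u) (n : ℕ) : (horner P c n U).mem P (∑ m ∈ range (n + 1), a m * u ^ m) := by
  unfold horner
  simpa using mem_hornerFrom P hc hu n 0

/-- Coefficients from a list (entries past the end are the point `0`). [folklore] -/
def coeffL (cs : List DI) (m : ℕ) : DI := cs.getD m (DI.pt 0)

/-- Interval Horner evaluation of the polynomial with coefficient LIST `cs` (degree `cs.length − 1`).
[folklore] -/
def hornerL (cs : List DI) (U : DI) : DI := horner P (coeffL cs) (cs.length - 1) U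

/-! ### Sub-intervals of `[0, H]` -/

/-- The `k`-th of `KS` closed sub-intervals of `[0, H]` (`H` rational), rounded outward to scale `2^P`:
`[⌊k H/KS · 2^P⌋, ⌈(k+1) H/KS · 2^P⌉]` (the kernel's `hull(of_frac(k Hq/KSUB), of_frac((k+1) Hq/KSUB))`).
[folklore] -/
def subI (H : ℚ) (KS k : ℕ) : DI :=
  ⟨⌊(k : ℚ) * H / KS * 2 ^ P⌋, ⌈((k : ℚ) + 1) * H / KS * 2 ^ P⌉⟩

/-- Soundness of `subI`: the real sub-interval lies in it. [folklore] -/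
theorem mem_subI (H : ℚ) (KS k : ℕ) {u : ℝ} (h1 : (k : ℝ) * (H : ℝ) / KS ≤ u)
    (h2 : u ≤ ((k : ℝ) + 1) * (H : ℝ) / KS) : (subI P H KS k).mem P u := by
  have h2P : (0 : ℝ) < 2 ^ P := by positivity
  constructor
  · have hfl : ((⌊(k : ℚ) * H / KS * 2 ^ P⌋ : ℤ) : ℝ) ≤ (((k : ℚ) * H / KS * 2 ^ P : ℚ) : ℝ) := by
      exact_mod_cast Int.floor_le ((k : ℚ) * H / KS * 2 ^ P)
    have hcast : (((k : ℚ) * H / KS * 2 ^ P : ℚ) : ℝ) = (k : ℝ) * (H : ℝ) / KS * 2 ^ P := by push_cast; ring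
    rw [hcast] at hfl
    exact hfl.trans (mul_le_mul_of_nonneg_right h1 h2P.le)
  · have hce : ((((k : ℚ) + 1) * H / KS * 2 ^ P : ℚ) : ℝ) ≤ ((⌈((k : ℚ) + 1) * H / KS * 2 ^ P⌉ : ℤ) : ℝ) := by
      exact_mod_cast Int.le_ceil (((k : ℚ) + 1) * H / KS * 2 ^ P)
    have hcast : ((((k : ℚ) + 1) * H / KS * 2 ^ P : ℚ) : ℝ) = ((k : ℝ) + 1) * (H : ℝ) / KS * 2 ^ P := by
      push_cast; ring
    rw [hcast] at hce
    exact (mul_le_mul_of_nonneg_right h2 h2P.le).trans hce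

/-- **Covering**: every `u ∈ [0, H]` (`0 < H`, `0 < KS`) lies in one of the `KS` closed sub-intervals
`[k H/KS, (k+1) H/KS]`, `k < KS`. [folklore] -/
theorem exists_subinterval {KS : ℕ} (hKS : 0 < KS) {H u : ℝ} (hH : 0 < H) (hu : u ∈ Set.Icc 0 H) :
    ∃ k : ℕ, k < KS ∧ (k : ℝ) * H / KS ≤ u ∧ u ≤ ((k : ℝ) + 1) * H / KS := by
  have hKSr : (0 : ℝ) < KS := by exact_mod_cast hKS
  by_cases hlt : u < H
  · have h0 : 0 ≤ u * KS / H := by have := hu.1; positivity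
    have hfl : (⌊u * KS / H⌋₊ : ℝ) ≤ u * KS / H := Nat.floor_le h0
    have hlt' : u * KS / H < ⌊u * KS / H⌋₊ + 1 := Nat.lt_floor_add_one _
    refine ⟨⌊u * KS / H⌋₊, ?_, ?_, ?_⟩
    · have hb : u * KS / H < KS := by
        rw [div_lt_iff₀ hH]
        nlinarith
      exact_mod_cast hfl.trans_lt hb
    · rw [div_le_iff₀ hKSr]
      have h := mul_le_mul_of_nonneg_right hfl hH.le
      rw [div_mul_cancel₀ _ hH.ne'] at h
      linarith
    · rw [le_div_iff₀ hKSr]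
      have h := mul_le_mul_of_nonneg_right hlt'.le hH.le
      rw [div_mul_cancel₀ _ hH.ne'] at h
      linarith
  · have huH : u = H := le_antisymm hu.2 (not_lt.1 hlt)
    refine ⟨KS - 1, Nat.sub_lt hKS one_pos, ?_, ?_⟩
    · rw [huH, div_le_iff₀ hKSr, Nat.cast_pred hKS]
      nlinarith
    · rw [huH, le_div_iff₀ hKSr, Nat.cast_pred hKS]
      linarith

/-- A bound certified on every sub-interval holds on `[0, H]`: if for each `k < KS` the value `g u`
lies in `V k` whenever `u ∈ subI P H KS k`, then `|g u| ≤ max-free bound` — stated pointwise: for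
`u ∈ [0,H]` there is `k < KS` with `u ∈ subI P H KS k`. [folklore] -/
theorem exists_mem_subI {KS : ℕ} (hKS : 0 < KS) (H : ℚ) (hH : (0 : ℝ) < H) {u : ℝ}
    (hu : u ∈ Set.Icc 0 (H : ℝ)) : ∃ k : ℕ, k < KS ∧ (subI P H KS k).mem P u := by
  obtain ⟨k, hk, h1, h2⟩ := exists_subinterval hKS hH hu
  exact ⟨k, hk, mem_subI P H KS k h1 h2⟩

/-- The uniform form used by the row checker: a magnitude bound `mag ≤ B` verified for the interval
value on EVERY sub-interval bounds `|g u|` by `B / 2^P` on all of `[0, H]`. [folklore] -/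
theorem abs_le_of_subintervals {KS : ℕ} (hKS : 0 < KS) (H : ℚ) (hH : (0 : ℝ) < H) {g : ℝ → ℝ}
    {G : ℕ → DI} (hG : ∀ k < KS, ∀ u : ℝ, (subI P H KS k).mem P u → (G k).mem P (g u)) {B : ℤ}
    (hB : ∀ k < KS, (G k).mag ≤ B) {u : ℝ} (hu : u ∈ Set.Icc 0 (H : ℝ)) :
    |g u| ≤ (B : ℝ) / 2 ^ P := by
  obtain ⟨k, hk, hmem⟩ := exists_mem_subI P hKS H hH hu
  have h := DI.abs_le_mag (hG k hk u hmem)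
  have hBk : ((G k).mag : ℝ) ≤ B := by exact_mod_cast hB k hk
  exact h.trans (div_le_div_of_nonneg_right hBk (by positivity))

end DIVec

end Summit.NavierStokesRegularity.FluidComputer
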